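/-
COR-CM (cell pub-hodgecm2, stage 2 of the Hodge ladder) — Δ2 BRIDGE, «ι₁/Id CHAIN» row I9 (ASSEMBLER MODULE TABLE v1∕v1.2, HOME/INBOX l.12622):
the Ω-slot (b) of the END and its `ω ≠ 0` input at the UNTWISTED App-C datum `Model.sec42DataIdOf` (instlevel-a, I1; `X_K := M_K`, the
cofan along ι₁), BY TRANSPORT from prove-7's live Ω-pin of record over the twisted datum `Model.sec42DataOf` through cmside-a's I3 transport
tools (`Model.uniformOmegaRepId`, `Model.exists_omegaPin_transport_uniformOmegaRepId`) — no twin of `OmegaPinAtLiuIndex ∕ OmegaPinAtDeltaPrime ∕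
OmegaAtDeltaPrime[Line]` (cmside-b's C-DEPENDENCE CENSUS f39482a416e0 §B).  Seat prover-pub-hodgecm2-rekey-l1-cmside-b-g3-0 (cmside-b g3).
THEOREMS ONLY; no `def`, no notation, no instance, no named fact, no `sorry`; every binder explicit; nothing landed is edited or restated.
FRAMING: HC_CM is NOT proved; «Δ2 BRIDGE CLOSED» is NOT claimed; hLiu = [Liu21] Thm 4.18 at the constructed objects AS A READING (r8).
-/
import Summits.HodgeConjecture.CorCM.D2Bridge.Iota1.UniformOmegaRep
import Summits.HodgeConjecture.CorCM.D2Bridge.OmegaPinAtLiuIndexOfRecord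
import Summits.HodgeConjecture.CorCM.B01.Transposition.Item6RestOfCharRep
import Summits.HodgeConjecture.HodgeCM.Model.LiuDictionaryPin
import Literature.NumberTheory.Automorphic.Liu2021.AppendixC.Prop413DataOfRestOne
import Literature.NumberTheory.Automorphic.Liu2021.Def45RMuFormSupply
import HarnessLib

set_option autoImplicit false

/-!
# Δ2 bridge, Id chain I9: the Ω-slot of record and `ω ≠ 0` at the UNTWISTED datum `sec42DataIdOf`

[Liu2021] Y. Liu, *Fourier–Jacobi cycles and arithmetic relative trace formula*, Camb. J. Math. **9** (2021) = arXiv:2102.11518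
(`l. NNNN` = lines of the author's TeX `FJcycle.tex`).

The END (`PortJoin/ClosedPrinted*.lean` §A = ✔ `PinSignatures.thm418C_liuDictionaryPin_of_pins` at the index of record) consumes, per good
index line `i` of the pinned dictionary, the binder group (b): a conjugate-symplectic weight-one `μ_i` with the `hadm` seam
`HasCMType μ_i (line i).lineType`, an injective admissible-index map `σ : {χ ∕∕ IsAutChar χ} → AdmIndex` of [Liu2021] Thm. 4.18's direct sum
and `ℂ[U(V)(𝔸_f)]`-identifications `e : (line i).Ω ιV χ ≃ ω(μ_i, ε, χ)`.  prove-7's ✔ `LiuIndex.OmegaPin.exists_pinTerms_indexOfRecord` supplies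
it at ANY rest family equal to F4's δ′ rest of record `restOfCharDeltaPrime … (2δ_F)⁻¹ (repOfLine a_i) μ hμ hw` over the TWISTED datum
`ℭ = sec42DataOf h isoOf …` — own-htheta's ✔ `restOfCharRep_eq_rest` (`rfl`) spells that rest as `(𝕌 i).rest 𝔱`, `𝕌 i = uniformOmegaRep …`.

THE TRANSPORT.  The types of `σ ∕ e ∕ he` read the rest only through `Thm418Data.AdmIndex ∕ omegaAt ∕ rhoAt`, i.e. through the μ-uniform
Weil carriers `Eps ∕ epsOf ∕ Chi ∕ omega ∕ rho`, `hμ` and the group `U(V)(𝔸_f)` — never through the datum's geometry or the one-object tail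
([Liu2021] Def. 4.11–4.12 vs Def. 4.5 (2), 4.16).  cmside-a's I3 (`Iota1/UniformOmegaRep.lean`) transports the carriers of record to the
UNTWISTED datum `ℭ₁ = sec42DataIdOf h isoOf …` by fields (`uniformOmegaRepId`, `𝕌₁ i`) and proves, at GENERIC tails and by `rfl`, that the three
types agree, packaged as `exists_omegaPin_transport_uniformOmegaRepId` (an Ω-pin datum at `(𝕌 i).rest t` IS one at `(𝕌₁ i).rest t₁`).  This file
instantiates: the live Ω-pin at the δ′ tail of record `𝔱`, transported to `(𝕌₁ i).rest (t₁ …)` for an ARBITRARY tail family `t₁` over `ℭ₁`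
(the END's `𝔱₁ := restTailOne (AlgHom.id ℚ _) ι₁ hμ hw 𝔠 (𝒯₁.rhoΩOne …)` over I2's `heckeTranslatesFamilyIdOf` included — I11 sets
`t₁ := fun i _ _ μ hμ hw => 𝔱₁`).  KERNEL-COST RULE (census (R-a); cmside-a's T1∕T2 probes; this seat's first farm run, `whnf` time-out at
6.4 M heartbeats): never compare `(ℭ₁, 𝕌₁, concrete tail)`- with `(ℭ, 𝕌, concrete tail)`-typed terms by bare definitional unfolding (the
twisted datum's `dite` on `4 ≤ [L:ℚ]` and the `cast` inside `heckeTranslatesFamilyOf` make `whnf` diverge); always go through I3's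
generic-tail lemmas, which INSTANTIATE for free.

* `exists_pinTerms_indexOfRecordId` — binder group (b) at `(𝕌₁ i).rest (t₁ …)`, families `μ ∕ hμ ∕ hw ∕ σ ∕ e` with `hadm ∕ hσ ∕ he`;
* `isIrreducible_rhoAt_indexOfRecordId_of_lemD1AsPrinted`, `nontrivial_omegaAt_indexOfRecordId_of_lemD1AsPrinted` — Def. 4.11's
  «irreducible» and `ω_j ≠ 0` for every admissible index `j` at those rests, from [Liu2021] App. D Lem. D.1 (1) AS PRINTED at the local Weil data
  of `j` (b10's ✔ `Def411WeilCarriers.rhoAtLine_isIrreducible_of_lemD1AsPrinted`, the tail-free core of F4's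
  `nontrivial_omegaAt_restOfCharDeltaPrime_of_lemD1AsPrinted`; `n = 3`, `ιV` onto).

Every input is a displayed END row (`h`, `h6`, `hemb`, `hD1`) or a tree term; nothing about Liu's objects is asserted.  HC_CM is NOT proved.

## References
* [Liu2021] Thm. 4.18 (l. 2232–2237), Def. 4.11 (l. 2088–2096), Def. 4.12 (l. 2102–2108), Prop. 4.13 (l. 2113–2119), Def. 4.5 (2)
  (l. 1944–1958), Def. 4.16 (l. 2219), App. D §D.1 Steps 1–3 (l. 5215–5221), Lemma D.1 (1) (l. 5229).
* [GelbartRogawski1991] S. Gelbart, J. Rogawski, *L-functions and Fourier–Jacobi coefficients for the unitary group U(3)*, Invent. Math.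
  105 (1991) — §3.1 Prop. 3.1.1 p. 455 L1–3.
* Tree: `CorCM/D2Bridge/OmegaPinAtLiuIndexOfRecord.lean`, `CorCM/D2Bridge/Iota1/UniformOmegaRep.lean`, `CorCM/D2Bridge/PinSignatures.lean`,
  `CorCM/B01/Transposition/Item6UniformOmegaRep.lean`, `…/Item6RestOfCharRep.lean`, `…/HComp/HonestP5Id.lean`, `…/HComp/Sec42DataIdOf.lean`,
  `Liu2021/Def411WeilCarriersAtLine.lean`, `Liu2021/AppendixC/Prop413DataOfTower.lean`, `…/Prop413DataOfRestOne.lean`, `…/Glue.lean`.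
-/

noncomputable section

open scoped TensorProduct Matrix

namespace Summit.HodgeConjecture.CorCM.D2Bridge.Iota1

open NumberField NumberField.InfinitePlace IsDedekindDomain
open HodgeCM.Model HodgeCM.Model.LiuIndex
open Summit.HodgeConjecture.CorCM.Model
open Literature.AlgebraicGeometry.Motives (CMType)
open Literature.AlgebraicGeometry.ShimuraVarieties.UnitaryCanonicalModel
open Literature.NumberTheory.Automorphic
open Literature.NumberTheory.Automorphic.IdeleClassGroup
open Literature.NumberTheory.Automorphic.Liu2021 Literature.NumberTheory.Automorphic.Liu2021.AppendixC
open Literature.NumberTheory.Automorphic.Liu2021.AppendixC.RestOne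
open Literature.NumberTheory.Automorphic.Liu2021.Def411WeilCarriers (locF Rep)
open Summit.HodgeConjecture.CorCM.Transposition (OmegaChiSplitting.chiLocalSplittingsD OmegaChiSplitting.hsChiD
  OmegaChiSplitting.hfac_sChiD)
open Summit.HodgeConjecture.CorCM.Transposition.OmegaTransport (realUnit)
open HodgeCM.Model.ArchSideTerm (e₁)
open Literature.NumberTheory.GelbartRogawski1991 Literature.NumberTheory.GelbartRogawski1991.UnitaryDualPair
open Literature.NumberTheory.GelbartRogawski1991.UnitaryDualPair.LocalSplitting (localMu norm_localMu continuous_localMu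
  localMu_toLocalRing_eq_one_iff)
open Literature.RepresentationTheory.Liu2021 (isOscillatorChar_toHeckeCharacter_iff)

/-! ## §1  The Ω-slot of record at the untwisted datum -/

set_option synthInstance.maxHeartbeats 400000 in
set_option maxHeartbeats 8000000 in
/-- **THE Ω-SLOT AT THE PINNED DICTIONARY OF RECORD OVER THE UNTWISTED DATUM `sec42DataIdOf`, INHABITED** — binder group (b) of
`PinSignatures.thm418C_liuDictionaryPin_of_pins` (`Good i := Continuous i.2.1`): families `μ ∕ hμ ∕ hw` (the conjugate-symplectic
weight-one characters OF THE LINES, X3-Char) with the `hadm` seam `HasCMType μ_i (line i).lineType`, the admissible index `σ` (injective,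
`hσ`), the identification `e` of the dictionary's `(line i).Ω ιV χ` with [Liu2021] Thm. 4.18's summand `ω(μ_i, ε, χ)` at the rests
`(𝕌₁ i).rest (t₁ …)` — the μ-uniform Weil carriers of record transported to the untwisted datum (cmside-a ✔ `uniformOmegaRepId`) over an
ARBITRARY tail family `t₁` (the END's `restTailOne … (heckeTranslatesFamilyIdOf …).rhoΩOne …` included) — and its `U(V)(𝔸_f)`-equivariance
`he`.  Proof: prove-7's ✔ `LiuIndex.OmegaPin.exists_pinTerms_indexOfRecord` at the rests of record `(𝕌 i).rest 𝔱` (own-htheta's ✔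
`restOfCharRep_eq_rest`, `rfl`), then cmside-a's ✔ `exists_omegaPin_transport_uniformOmegaRepId` instantiated at `(t₁ …, 𝔱)` line by line
(`choose`).  HC_CM is NOT proved; «Δ2 BRIDGE CLOSED» is NOT claimed.
[cite: Liu2021, Thm. 4.18 (FJcycle.tex l. 2232–2237), Def. 4.11 (l. 2088–2096), Def. 4.12 (l. 2102–2108), Prop. 4.13 (l. 2113–2119), App. D §D.1 Steps 1–3 (l. 5215–5221)]
[cite: GelbartRogawski1991, §3.1 Prop. 3.1.1 p. 455 L1–3] -/
theorem exists_pinTerms_indexOfRecordId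
    {L : HodgeCM.CMField} {ι₁ : (L : Type) →+* ℂ} (V : HodgeCM.HermSpace3 L ι₁) (a₀ : RealScalar L)
    (ιV : ↥V.adelicFin →*
      ↥(UnitaryGroup.finAdelic (↥(maximalRealSubfield (L : Type))) (L : Type) (IsCMField.complexConj (L : Type)) 3
        (Matrix.diagonal (frameD V))))
    (h : exists_recordSystem) [IsGalois ℚ (L : Type)] (h6 : 6 ≤ Module.finrank ℚ (L : Type)) (Φ : CMType (L : Type))
    (hemb : (InfinitePlace.mk ι₁).embedding = ι₁)
    (t₁ : ∀ (i : (I V (repAt a₀) (muLiu ι₁ GramClass.rep))) (_ : SplitLine.PhiMuLine ι₁ ((line V (repAt a₀) (muLiu ι₁ GramClass.rep)) i)) (_ : Continuous (i.2.1 : SplittingAt V (repAt a₀ i.1)))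
      (μ : Literature.NumberTheory.Automorphic.IdeleClassGroup (L : Type) →ₜ* Circle) (hμ : IsConjugateSymplectic (L : Type) μ)
      (_ : HasWeight (L : Type) μ 1), RestTail (sec42DataIdOf h isoOf ⟨HodgeCM.CMField.K L⟩ ι₁ ⟨HodgeCM.HermSpace3.Hm V, HodgeCM.HermSpace3.isHermitian V, HodgeCM.HermSpace3.signature_ι₁ V, HodgeCM.HermSpace3.posDef_of_ne V⟩ Φ) μ hμ) :
    ∃ (μ : ∀ i : (I V (repAt a₀) (muLiu ι₁ GramClass.rep)),
        SplitLine.PhiMuLine ι₁ ((line V (repAt a₀) (muLiu ι₁ GramClass.rep)) i) → Continuous (i.2.1 : SplittingAt V (repAt a₀ i.1)) →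
          (Literature.NumberTheory.Automorphic.IdeleClassGroup (L : Type) →ₜ* Circle))
      (hμ : ∀ (i : (I V (repAt a₀) (muLiu ι₁ GramClass.rep))) (hi : SplitLine.PhiMuLine ι₁ ((line V (repAt a₀) (muLiu ι₁ GramClass.rep)) i)) (hg : Continuous (i.2.1 : SplittingAt V (repAt a₀ i.1))), IsConjugateSymplectic (L : Type) (μ i hi hg))
      (hw : ∀ (i : (I V (repAt a₀) (muLiu ι₁ GramClass.rep))) (hi : SplitLine.PhiMuLine ι₁ ((line V (repAt a₀) (muLiu ι₁ GramClass.rep)) i)) (hg : Continuous (i.2.1 : SplittingAt V (repAt a₀ i.1))), HasWeight (L : Type) (μ i hi hg) 1)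
      (σ : ∀ (i : (I V (repAt a₀) (muLiu ι₁ GramClass.rep))) (hi : SplitLine.PhiMuLine ι₁ ((line V (repAt a₀) (muLiu ι₁ GramClass.rep)) i)) (hg : Continuous (i.2.1 : SplittingAt V (repAt a₀ i.1))), {χ : ((line V (repAt a₀) (muLiu ι₁ GramClass.rep)) i).CharW // ((line V (repAt a₀) (muLiu ι₁ GramClass.rep)) i).IsAutChar χ} → (toThm418Data (sec42DataIdOf h isoOf ⟨HodgeCM.CMField.K L⟩ ι₁ ⟨HodgeCM.HermSpace3.Hm V, HodgeCM.HermSpace3.isHermitian V, HodgeCM.HermSpace3.signature_ι₁ V, HodgeCM.HermSpace3.posDef_of_ne V⟩ Φ) ((uniformOmegaRepId h ⟨HodgeCM.CMField.K L⟩ ι₁ ⟨HodgeCM.HermSpace3.Hm V, HodgeCM.HermSpace3.isHermitian V, HodgeCM.HermSpace3.signature_ι₁ V, HodgeCM.HermSpace3.posDef_of_ne V⟩ Φ e₁ (frameD V) (frameD_real V) (frameD_ne V) ιV (2 * imagUnit (HodgeCM.CMField.K L))⁻¹ (fun _ _ => (Rep.update ↥(maximalRealSubfield (HodgeCM.CMField.K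 L)) (imagUnitSq (HodgeCM.CMField.K L)) (Rep.ofLineOf ↥(maximalRealSubfield (HodgeCM.CMField.K L)) (imagUnitSq (HodgeCM.CMField.K L))) (locF ↥(maximalRealSubfield (HodgeCM.CMField.K L)) (imagUnitSq (HodgeCM.CMField.K L)) (realUnit ⟨HodgeCM.CMField.K L⟩ (repAt a₀ (Sigma.fst i)).1 (repAt a₀ (Sigma.fst i)).2.1 (repAt a₀ (Sigma.fst i)).2.2)) (realUnit ⟨HodgeCM.CMField.K L⟩ (repAt a₀ (Sigma.fst i)).1 (repAt a₀ (Sigma.fst i)).2.1 (repAt a₀ (Sigma.fst i)).2.2) rfl))).rest (t₁ i hi hg (μ i hi hg) (hμ i hi hg) (hw i hi hg)))).AdmIndex)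
      (e : ∀ (i : (I V (repAt a₀) (muLiu ι₁ GramClass.rep))) (hi : SplitLine.PhiMuLine ι₁ ((line V (repAt a₀) (muLiu ι₁ GramClass.rep)) i)) (hg : Continuous (i.2.1 : SplittingAt V (repAt a₀ i.1))) (a : {χ : ((line V (repAt a₀) (muLiu ι₁ GramClass.rep)) i).CharW // ((line V (repAt a₀) (muLiu ι₁ GramClass.rep)) i).IsAutChar χ}), ((line V (repAt a₀) (muLiu ι₁ GramClass.rep)) i).Ω ιV a.1 ≃ₗ[ℂ] (toThm418Data (sec42DataIdOf h isoOf ⟨HodgeCM.CMField.K L⟩ ι₁ ⟨HodgeCM.HermSpace3.Hm V, HodgeCM.HermSpace3.isHermitian V, HodgeCM.HermSpace3.signature_ι₁ V, HodgeCM.HermSpace3.posDef_of_ne V⟩ Φ) ((uniformOmegaRepId h ⟨HodgeCM.CMField.K L⟩ ι₁ ⟨HodgeCM.HermSpace3.Hm V, HodgeCM.HermSpace3.isHermitian V, HodgeCM.HermSpace3.signature_ι₁ V, HodgeCM.HermSpace3.posDef_of_ne V⟩ Φ e₁ (frameD V) (frameD_real V) (frameD_ne V) ιV (2 * imagUnit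 (HodgeCM.CMField.K L))⁻¹ (fun _ _ => (Rep.update ↥(maximalRealSubfield (HodgeCM.CMField.K L)) (imagUnitSq (HodgeCM.CMField.K L)) (Rep.ofLineOf ↥(maximalRealSubfield (HodgeCM.CMField.K L)) (imagUnitSq (HodgeCM.CMField.K L))) (locF ↥(maximalRealSubfield (HodgeCM.CMField.K L)) (imagUnitSq (HodgeCM.CMField.K L)) (realUnit ⟨HodgeCM.CMField.K L⟩ (repAt a₀ (Sigma.fst i)).1 (repAt a₀ (Sigma.fst i)).2.1 (repAt a₀ (Sigma.fst i)).2.2)) (realUnit ⟨HodgeCM.CMField.K L⟩ (repAt a₀ (Sigma.fst i)).1 (repAt a₀ (Sigma.fst i)).2.1 (repAt a₀ (Sigma.fst i)).2.2) rfl))).rest (t₁ i hi hg (μ i hi hg) (hμ i hi hg) (hw i hi hg)))).omegaAt (σ i hi hg a)),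
      (∀ (i : (I V (repAt a₀) (muLiu ι₁ GramClass.rep))) (hi : SplitLine.PhiMuLine ι₁ ((line V (repAt a₀) (muLiu ι₁ GramClass.rep)) i)) (hg : Continuous (i.2.1 : SplittingAt V (repAt a₀ i.1))), HasCMType (L : Type) (μ i hi hg) ((line V (repAt a₀) (muLiu ι₁ GramClass.rep)) i).lineType) ∧
      (∀ (i : (I V (repAt a₀) (muLiu ι₁ GramClass.rep))) (hi : SplitLine.PhiMuLine ι₁ ((line V (repAt a₀) (muLiu ι₁ GramClass.rep)) i)) (hg : Continuous (i.2.1 : SplittingAt V (repAt a₀ i.1))), Function.Injective (σ i hi hg)) ∧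
      (∀ (i : (I V (repAt a₀) (muLiu ι₁ GramClass.rep))) (hi : SplitLine.PhiMuLine ι₁ ((line V (repAt a₀) (muLiu ι₁ GramClass.rep)) i)) (hg : Continuous (i.2.1 : SplittingAt V (repAt a₀ i.1))) (a : {χ : ((line V (repAt a₀) (muLiu ι₁ GramClass.rep)) i).CharW // ((line V (repAt a₀) (muLiu ι₁ GramClass.rep)) i).IsAutChar χ}) (g : ↥V.adelicFin) (m : ((line V (repAt a₀) (muLiu ι₁ GramClass.rep)) i).Ω ιV a.1),
          e i hi hg a (MonoidAlgebra.of ℂ ↥V.adelicFin g • m) = (toThm418Data (sec42DataIdOf h isoOf ⟨HodgeCM.CMField.K L⟩ ι₁ ⟨HodgeCM.HermSpace3.Hm V, HodgeCM.HermSpace3.isHermitian V, HodgeCM.HermSpace3.signature_ι₁ V, HodgeCM.HermSpace3.posDef_of_ne V⟩ Φ) ((uniformOmegaRepId h ⟨HodgeCM.CMField.K L⟩ ι₁ ⟨HodgeCM.HermSpace3.Hm V, HodgeCM.HermSpace3.isHermitian V, HodgeCM.HermSpace3.signature_ι₁ V, HodgeCM.HermSpace3.posDef_of_ne V⟩ Φ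 e₁ (frameD V) (frameD_real V) (frameD_ne V) ιV (2 * imagUnit (HodgeCM.CMField.K L))⁻¹ (fun _ _ => (Rep.update ↥(maximalRealSubfield (HodgeCM.CMField.K L)) (imagUnitSq (HodgeCM.CMField.K L)) (Rep.ofLineOf ↥(maximalRealSubfield (HodgeCM.CMField.K L)) (imagUnitSq (HodgeCM.CMField.K L))) (locF ↥(maximalRealSubfield (HodgeCM.CMField.K L)) (imagUnitSq (HodgeCM.CMField.K L)) (realUnit ⟨HodgeCM.CMField.K L⟩ (repAt a₀ (Sigma.fst i)).1 (repAt a₀ (Sigma.fst i)).2.1 (repAt a₀ (Sigma.fst i)).2.2)) (realUnit ⟨HodgeCM.CMField.K L⟩ (repAt a₀ (Sigma.fst i)).1 (repAt a₀ (Sigma.fst i)).2.1 (repAt a₀ (Sigma.fst i)).2.2) rfl))).rest (t₁ i hi hg (μ i hi hg) (hμ i hi hg) (hw i hi hg)))).rhoAt (σ i hi hg a) g (e i hi hg a m)) := by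
  -- F4's δ′ rest of record IS `(𝕌 i).rest 𝔱` (own-htheta ✔ `restOfCharRep_eq_rest`, `rfl`) — edition 2's `eR`, verbatim
  have eR : ∀ (i : (I V (repAt a₀) (muLiu ι₁ GramClass.rep))) (μ : Literature.NumberTheory.Automorphic.IdeleClassGroup (L : Type) →ₜ* Circle)
      (hμ : IsConjugateSymplectic (L : Type) μ) (hw : HasWeight (L : Type) μ 1),
      restOfCharDeltaPrime h ⟨HodgeCM.CMField.K L⟩ h6 ι₁ ⟨HodgeCM.HermSpace3.Hm V, HodgeCM.HermSpace3.isHermitian V, HodgeCM.HermSpace3.signature_ι₁ V, HodgeCM.HermSpace3.posDef_of_ne V⟩ Φ e₁ (frameD V) (frameD_real V) (frameD_ne V) ιV (Rep.update ↥(maximalRealSubfield (HodgeCM.CMField.K L)) (imagUnitSq (HodgeCM.CMField.K L)) (Rep.ofLineOf ↥(maximalRealSubfield (HodgeCM.CMField.K L)) (imagUnitSq (HodgeCM.CMField.K L))) (locF ↥(maximalRealSubfield (HodgeCM.CMField.K L)) (imagUnitSq (HodgeCM.CMField.K L)) (realUnit ⟨HodgeCM.CMField.K L⟩ (repAt a₀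 (Sigma.fst i)).1 (repAt a₀ (Sigma.fst i)).2.1 (repAt a₀ (Sigma.fst i)).2.2)) (realUnit ⟨HodgeCM.CMField.K L⟩ (repAt a₀ (Sigma.fst i)).1 (repAt a₀ (Sigma.fst i)).2.1 (repAt a₀ (Sigma.fst i)).2.2) rfl) μ hμ hw =
        (uniformOmegaRep h ⟨HodgeCM.CMField.K L⟩ ι₁ ⟨HodgeCM.HermSpace3.Hm V, HodgeCM.HermSpace3.isHermitian V, HodgeCM.HermSpace3.signature_ι₁ V, HodgeCM.HermSpace3.posDef_of_ne V⟩ Φ e₁ (frameD V) (frameD_real V) (frameD_ne V) ιV (2 * imagUnit (HodgeCM.CMField.K L))⁻¹ (fun _ _ => (Rep.update ↥(maximalRealSubfield (HodgeCM.CMField.K L)) (imagUnitSq (HodgeCM.CMField.K L)) (Rep.ofLineOf ↥(maximalRealSubfield (HodgeCM.CMField.K L)) (imagUnitSq (HodgeCM.CMField.K L))) (locF ↥(maximalRealSubfield (HodgeCM.CMField.K L)) (imagUnitSq (HodgeCM.CMField.K L)) (realUnit ⟨HodgeCM.CMField.K L⟩ (repAt a₀ (Sigma.fst i)).1 (repAt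 a₀ (Sigma.fst i)).2.1 (repAt a₀ (Sigma.fst i)).2.2)) (realUnit ⟨HodgeCM.CMField.K L⟩ (repAt a₀ (Sigma.fst i)).1 (repAt a₀ (Sigma.fst i)).2.1 (repAt a₀ (Sigma.fst i)).2.2) rfl))).rest (restTailOne (AlgHom.id ℚ _) ι₁ hμ hw (Def45.Carriers.ofPolDR μ (Def45.PolDR ι₁ hμ (Def45.RMuForm ι₁ hμ))) ((heckeTranslatesFamilyOf heckeTranslate_definedOver_holds h isoOf ⟨HodgeCM.CMField.K L⟩ ι₁ ⟨HodgeCM.HermSpace3.Hm V, HodgeCM.HermSpace3.isHermitian V, HodgeCM.HermSpace3.signature_ι₁ V, HodgeCM.HermSpace3.posDef_of_ne V⟩ Φ h6).rhoΩOne (AlgHom.id ℚ _) ι₁ hμ hw (Def45.Carriers.ofPolDR μ (Def45.PolDR ι₁ hμ (Def45.RMuForm ι₁ hμ))))) := fun i μ hμ hw =>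
    restOfCharRep_eq_rest h ⟨HodgeCM.CMField.K L⟩ ι₁ ⟨HodgeCM.HermSpace3.Hm V, HodgeCM.HermSpace3.isHermitian V, HodgeCM.HermSpace3.signature_ι₁ V, HodgeCM.HermSpace3.posDef_of_ne V⟩ Φ e₁ (frameD V) (frameD_real V) (frameD_ne V) ιV
      (2 * imagUnit (HodgeCM.CMField.K L))⁻¹ (fun _ _ => (Rep.update ↥(maximalRealSubfield (HodgeCM.CMField.K L)) (imagUnitSq (HodgeCM.CMField.K L)) (Rep.ofLineOf ↥(maximalRealSubfield (HodgeCM.CMField.K L)) (imagUnitSq (HodgeCM.CMField.K L))) (locF ↥(maximalRealSubfield (HodgeCM.CMField.K L)) (imagUnitSq (HodgeCM.CMField.K L)) (realUnit ⟨HodgeCM.CMField.K L⟩ (repAt a₀ (Sigma.fst i)).1 (repAt a₀ (Sigma.fst i)).2.1 (repAt a₀ (Sigma.fst i)).2.2)) (realUnit ⟨HodgeCM.CMField.K L⟩ (repAt a₀ (Sigma.fst i)).1 (repAt a₀ (Sigma.fst i)).2.1 (repAt a₀ (Sigma.fst i)).2.2) rfl)) h6 μ hμ hw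
  have H := HodgeCM.Model.LiuIndex.OmegaPin.exists_pinTerms_indexOfRecord V a₀ ιV h h6 Φ hemb
    (fun i _ _ μ hμ hw => (uniformOmegaRep h ⟨HodgeCM.CMField.K L⟩ ι₁ ⟨HodgeCM.HermSpace3.Hm V, HodgeCM.HermSpace3.isHermitian V, HodgeCM.HermSpace3.signature_ι₁ V, HodgeCM.HermSpace3.posDef_of_ne V⟩ Φ e₁ (frameD V) (frameD_real V) (frameD_ne V) ιV (2 * imagUnit (HodgeCM.CMField.K L))⁻¹ (fun _ _ => (Rep.update ↥(maximalRealSubfield (HodgeCM.CMField.K L)) (imagUnitSq (HodgeCM.CMField.K L)) (Rep.ofLineOf ↥(maximalRealSubfield (HodgeCM.CMField.K L)) (imagUnitSq (HodgeCM.CMField.K L))) (locF ↥(maximalRealSubfield (HodgeCM.CMField.K L)) (imagUnitSq (HodgeCM.CMField.K L)) (realUnit ⟨HodgeCM.CMField.K L⟩ (repAt a₀ (Sigma.fst i)).1 (repAt a₀ (Sigma.fst i)).2.1 (repAt a₀ (Sigma.fst i)).2.2)) (realUnit ⟨HodgeCM.CMField.K L⟩ (repAt a₀ (Sigma.fst i)).1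 (repAt a₀ (Sigma.fst i)).2.1 (repAt a₀ (Sigma.fst i)).2.2) rfl))).rest (restTailOne (AlgHom.id ℚ _) ι₁ hμ hw (Def45.Carriers.ofPolDR μ (Def45.PolDR ι₁ hμ (Def45.RMuForm ι₁ hμ))) ((heckeTranslatesFamilyOf heckeTranslate_definedOver_holds h isoOf ⟨HodgeCM.CMField.K L⟩ ι₁ ⟨HodgeCM.HermSpace3.Hm V, HodgeCM.HermSpace3.isHermitian V, HodgeCM.HermSpace3.signature_ι₁ V, HodgeCM.HermSpace3.posDef_of_ne V⟩ Φ h6).rhoΩOne (AlgHom.id ℚ _) ι₁ hμ hw (Def45.Carriers.ofPolDR μ (Def45.PolDR ι₁ hμ (Def45.RMuForm ι₁ hμ)))))) (fun i _ _ μ hμ hw => eR i μ hμ hw)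
  obtain ⟨μ, hμ, hw, σ, e, hcm, hσ, he⟩ := H
  choose σ₁ e₁ hσ₁ he₁ using fun (i : (I V (repAt a₀) (muLiu ι₁ GramClass.rep))) (hi : SplitLine.PhiMuLine ι₁ ((line V (repAt a₀) (muLiu ι₁ GramClass.rep)) i)) (hg : Continuous (i.2.1 : SplittingAt V (repAt a₀ i.1))) =>
    exists_omegaPin_transport_uniformOmegaRepId h ⟨HodgeCM.CMField.K L⟩ ι₁ ⟨HodgeCM.HermSpace3.Hm V, HodgeCM.HermSpace3.isHermitian V, HodgeCM.HermSpace3.signature_ι₁ V, HodgeCM.HermSpace3.posDef_of_ne V⟩ Φ e₁ (frameD V) (frameD_real V) (frameD_ne V) ιV (2 * imagUnit (HodgeCM.CMField.K L))⁻¹ (fun _ _ => (Rep.update ↥(maximalRealSubfield (HodgeCM.CMField.K L)) (imagUnitSq (HodgeCM.CMField.K L)) (Rep.ofLineOf ↥(maximalRealSubfield (HodgeCM.CMField.K L)) (imagUnitSq (HodgeCM.CMField.K L))) (locF ↥(maximalRealSubfield (HodgeCM.CMField.K L)) (imagUnitSq (HodgeCM.CMField.K L)) (realUnit ⟨HodgeCM.CMField.K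 L⟩ (repAt a₀ (Sigma.fst i)).1 (repAt a₀ (Sigma.fst i)).2.1 (repAt a₀ (Sigma.fst i)).2.2)) (realUnit ⟨HodgeCM.CMField.K L⟩ (repAt a₀ (Sigma.fst i)).1 (repAt a₀ (Sigma.fst i)).2.1 (repAt a₀ (Sigma.fst i)).2.2) rfl))
      (t₁ i hi hg (μ i hi hg) (hμ i hi hg) (hw i hi hg)) (restTailOne (AlgHom.id ℚ _) ι₁ (hμ i hi hg) (hw i hi hg) (Def45.Carriers.ofPolDR (μ i hi hg) (Def45.PolDR ι₁ (hμ i hi hg) (Def45.RMuForm ι₁ (hμ i hi hg)))) ((heckeTranslatesFamilyOf heckeTranslate_definedOver_holds h isoOf ⟨HodgeCM.CMField.K L⟩ ι₁ ⟨HodgeCM.HermSpace3.Hm V, HodgeCM.HermSpace3.isHermitian V, HodgeCM.HermSpace3.signature_ι₁ V, HodgeCM.HermSpace3.posDef_of_ne V⟩ Φ h6).rhoΩOne (AlgHom.id ℚ _) ι₁ (hμ i hi hg) (hw i hi hg) (Def45.Carriers.ofPolDR (μ i hi hg) (Def45.PolDR ι₁ (hμ i hi hg) (Def45.RMuForm ι₁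 (hμ i hi hg))))))
      (fun (a : {χ : ((line V (repAt a₀) (muLiu ι₁ GramClass.rep)) i).CharW // ((line V (repAt a₀) (muLiu ι₁ GramClass.rep)) i).IsAutChar χ}) (g : ↥V.adelicFin) (m : ((line V (repAt a₀) (muLiu ι₁ GramClass.rep)) i).Ω ιV a.1) => MonoidAlgebra.of ℂ ↥V.adelicFin g • m)
      (σ i hi hg) (e i hi hg) (hσ i hi hg) (he i hi hg)
  exact ⟨μ, hμ, hw, σ₁, e₁, hcm, hσ₁, he₁⟩


/-! ## §2  Def. 4.11's «irreducible» and `ω ≠ 0` at the untwisted datum, from [Liu2021, App. D Lem. D.1 (1)] AS PRINTED -/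

set_option synthInstance.maxHeartbeats 400000 in
set_option maxHeartbeats 6400000 in
/-- **`ω_j` IS IRREDUCIBLE at the rests `(𝕌₁ i).rest t` over the untwisted datum**, for every admissible index `j` of [Liu2021] Thm. 4.18's
direct sum, from App. D Lem. D.1 (1) AS PRINTED at the local Weil data of `j` (`hD1`): b10's tail-free core
`Def411WeilCarriers.rhoAtLine_isIrreducible_of_lemD1AsPrinted` (the summand is `rhoAtLine … ιV ((repOfLine a_i) ε) χ` by unfolding the
transported carriers; `n = 3`; `ιV` onto = `hιs`).  The shape F4's `nontrivial_omegaAt_restOfCharDeltaPrime_of_lemD1AsPrinted` has over the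
twisted datum, read at the untwisted one for ANY tail `t`.  HC_CM is NOT proved.
[cite: Liu2021, Def. 4.11 (FJcycle.tex l. 2090–2096), Appendix D §D.1 Steps 1–3 (l. 5217–5221), Lemma D.1 (1) (l. 5229)]
[cite: GelbartRogawski1991, §3.1 Prop. 3.1.1 p. 455 L1–3] -/
theorem isIrreducible_rhoAt_indexOfRecordId_of_lemD1AsPrinted
    {L : HodgeCM.CMField} {ι₁ : (L : Type) →+* ℂ} (V : HodgeCM.HermSpace3 L ι₁) (a₀ : RealScalar L)
    (ιV : ↥V.adelicFin →*
      ↥(UnitaryGroup.finAdelic (↥(maximalRealSubfield (L : Type))) (L : Type) (IsCMField.complexConj (L : Type)) 3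
        (Matrix.diagonal (frameD V))))
    (h : exists_recordSystem) [IsGalois ℚ (L : Type)] (Φ : CMType (L : Type))
    (i : (I V (repAt a₀) (muLiu ι₁ GramClass.rep))) (μ : Literature.NumberTheory.Automorphic.IdeleClassGroup (L : Type) →ₜ* Circle)
    (hμ : IsConjugateSymplectic (L : Type) μ) (hιs : Function.Surjective ιV)
    (t : RestTail (sec42DataIdOf h isoOf ⟨HodgeCM.CMField.K L⟩ ι₁ ⟨HodgeCM.HermSpace3.Hm V, HodgeCM.HermSpace3.isHermitian V, HodgeCM.HermSpace3.signature_ι₁ V, HodgeCM.HermSpace3.posDef_of_ne V⟩ Φ) μ hμ) (j : (toThm418Data (sec42DataIdOf h isoOf ⟨HodgeCM.CMField.K L⟩ ι₁ ⟨HodgeCM.HermSpace3.Hm V, HodgeCM.HermSpace3.isHermitian V, HodgeCM.HermSpace3.signature_ι₁ V, HodgeCM.HermSpace3.posDef_of_ne V⟩ Φ) ((uniformOmegaRepId h ⟨HodgeCM.CMField.K L⟩ ι₁ ⟨HodgeCM.HermSpace3.Hm V, HodgeCM.HermSpace3.isHermitian V, HodgeCM.HermSpace3.signature_ι₁ V,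 HodgeCM.HermSpace3.posDef_of_ne V⟩ Φ e₁ (frameD V) (frameD_real V) (frameD_ne V) ιV (2 * imagUnit (HodgeCM.CMField.K L))⁻¹ (fun _ _ => (Rep.update ↥(maximalRealSubfield (HodgeCM.CMField.K L)) (imagUnitSq (HodgeCM.CMField.K L)) (Rep.ofLineOf ↥(maximalRealSubfield (HodgeCM.CMField.K L)) (imagUnitSq (HodgeCM.CMField.K L))) (locF ↥(maximalRealSubfield (HodgeCM.CMField.K L)) (imagUnitSq (HodgeCM.CMField.K L)) (realUnit ⟨HodgeCM.CMField.K L⟩ (repAt a₀ (Sigma.fst i)).1 (repAt a₀ (Sigma.fst i)).2.1 (repAt a₀ (Sigma.fst i)).2.2)) (realUnit ⟨HodgeCM.CMField.K L⟩ (repAt a₀ (Sigma.fst i)).1 (repAt a₀ (Sigma.fst i)).2.1 (repAt a₀ (Sigma.fst i)).2.2) rfl))).rest t)).AdmIndex)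
    (hD1 : ∀ v : HeightOneSpectrum (𝓞 ↥(maximalRealSubfield (L : Type))), LemD1_1AsPrinted
      (Def411WeilCarriers.localLemD1Data ↥(maximalRealSubfield (L : Type)) (L : Type) (IsCMField.complexConj (L : Type)) 3 e₁
        (Matrix.diagonal (frameD V)) (complexConj_imagUnit (L : Type)) (imagUnit_ne_zero (L : Type)) (imagUnit_mul_self (L : Type))
        (realDiagonal_isSymm (L : Type) (frameD V) (frameD_real V))
        (isUnit_det_realDiagonal (L : Type) (frameD V) (frameD_real V) (frameD_ne V))
        (realDiagonal_map (L : Type) (frameD V) (frameD_real V)).symm ((Rep.update ↥(maximalRealSubfield (HodgeCM.CMField.K L)) (imagUnitSq (HodgeCM.CMField.K L)) (Rep.ofLineOf ↥(maximalRealSubfield (HodgeCM.CMField.K L)) (imagUnitSq (HodgeCM.CMField.K L))) (locF ↥(maximalRealSubfield (HodgeCM.CMField.K L)) (imagUnitSq (HodgeCM.CMField.K L)) (realUnit ⟨HodgeCM.CMField.K L⟩ (repAt a₀ (Sigma.fst i)).1 (repAt a₀ (Sigma.fst i)).2.1 (repAt a₀ (Sigma.fst i)).2.2)) (realUnit ⟨HodgeCM.CMField.K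 L⟩ (repAt a₀ (Sigma.fst i)).1 (repAt a₀ (Sigma.fst i)).2.1 (repAt a₀ (Sigma.fst i)).2.2) rfl).toFun j.1.1)
        (OmegaChiSplitting.chiLocalSplittingsD ⟨HodgeCM.CMField.K L⟩ e₁ (frameD V) (frameD_real V) (frameD_ne V)
          (toHeckeCharacter (L : Type) μ) ((isOscillatorChar_toHeckeCharacter_iff μ).mpr hμ) ((Rep.update ↥(maximalRealSubfield (HodgeCM.CMField.K L)) (imagUnitSq (HodgeCM.CMField.K L)) (Rep.ofLineOf ↥(maximalRealSubfield (HodgeCM.CMField.K L)) (imagUnitSq (HodgeCM.CMField.K L))) (locF ↥(maximalRealSubfield (HodgeCM.CMField.K L)) (imagUnitSq (HodgeCM.CMField.K L)) (realUnit ⟨HodgeCM.CMField.K L⟩ (repAt a₀ (Sigma.fst i)).1 (repAt a₀ (Sigma.fst i)).2.1 (repAt a₀ (Sigma.fst i)).2.2)) (realUnit ⟨HodgeCM.CMField.K L⟩ (repAt a₀ (Sigma.fst i)).1 (repAt a₀ (Sigma.fst i)).2.1 (repAt a₀ (Sigma.fst i)).2.2) rfl).toFun j.1.1))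
        (le_refl 3) (localMu (L : Type) (toHeckeCharacter (L : Type) μ))
        (fun v x => norm_localMu (L : Type) (toHeckeCharacter (L : Type) μ) v (isUnitary_toHeckeCharacter (L : Type) μ) x)
        (continuous_localMu (L : Type) (toHeckeCharacter (L : Type) μ))
        (fun v t => localMu_toLocalRing_eq_one_iff (L : Type) (toHeckeCharacter (L : Type) μ) v
          ((isOscillatorChar_toHeckeCharacter_iff μ).mpr hμ) t)
        j.1.2.1
        (Def411WeilCarriers.norm_chi_eq_one ↥(maximalRealSubfield (L : Type)) (L : Type) (IsCMField.complexConj (L : Type))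
          (Algebra.IsQuadraticExtension.finrank_eq_two ↥(maximalRealSubfield (L : Type)) (L : Type))
          (UnitaryGroup.algEquiv_ne_one_of_apply_eq_neg ↥(maximalRealSubfield (L : Type)) (L : Type) (IsCMField.complexConj (L : Type))
            (complexConj_imagUnit (L : Type)) (imagUnit_ne_zero (L : Type))) j.1.2)
        j.1.2.2.1 v)) :
    ((toThm418Data (sec42DataIdOf h isoOf ⟨HodgeCM.CMField.K L⟩ ι₁ ⟨HodgeCM.HermSpace3.Hm V, HodgeCM.HermSpace3.isHermitian V, HodgeCM.HermSpace3.signature_ι₁ V, HodgeCM.HermSpace3.posDef_of_ne V⟩ Φ) ((uniformOmegaRepId h ⟨HodgeCM.CMField.K L⟩ ι₁ ⟨HodgeCM.HermSpace3.Hm V, HodgeCM.HermSpace3.isHermitian V, HodgeCM.HermSpace3.signature_ι₁ V, HodgeCM.HermSpace3.posDef_of_ne V⟩ Φ e₁ (frameD V) (frameD_real V) (frameD_ne V) ιV (2 * imagUnit (HodgeCM.CMField.K L))⁻¹ (fun _ _ => (Rep.update ↥(maximalRealSubfield (HodgeCM.CMField.K L)) (imagUnitSq (HodgeCM.CMField.K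 L)) (Rep.ofLineOf ↥(maximalRealSubfield (HodgeCM.CMField.K L)) (imagUnitSq (HodgeCM.CMField.K L))) (locF ↥(maximalRealSubfield (HodgeCM.CMField.K L)) (imagUnitSq (HodgeCM.CMField.K L)) (realUnit ⟨HodgeCM.CMField.K L⟩ (repAt a₀ (Sigma.fst i)).1 (repAt a₀ (Sigma.fst i)).2.1 (repAt a₀ (Sigma.fst i)).2.2)) (realUnit ⟨HodgeCM.CMField.K L⟩ (repAt a₀ (Sigma.fst i)).1 (repAt a₀ (Sigma.fst i)).2.1 (repAt a₀ (Sigma.fst i)).2.2) rfl))).rest t)).rhoAt j).IsIrreducible :=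
  Def411WeilCarriers.rhoAtLine_isIrreducible_of_lemD1AsPrinted ↥(maximalRealSubfield (L : Type)) (L : Type)
    (IsCMField.complexConj (L : Type)) 3 e₁ (Matrix.diagonal (frameD V)) (complexConj_imagUnit (L : Type)) (imagUnit_ne_zero (L : Type))
    (imagUnit_mul_self (L : Type)) (realDiagonal_isSymm (L : Type) (frameD V) (frameD_real V))
    (isUnit_det_realDiagonal (L : Type) (frameD V) (frameD_real V) (frameD_ne V)) (realDiagonal_map (L : Type) (frameD V) (frameD_real V)).symm
    (OmegaChiSplitting.hsChiD ⟨HodgeCM.CMField.K L⟩ e₁ (frameD V) (frameD_real V) (frameD_ne V) (toHeckeCharacter (L : Type) μ)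
      (isUnitary_toHeckeCharacter (L : Type) μ) ((isOscillatorChar_toHeckeCharacter_iff μ).mpr hμ))
    ((Rep.update ↥(maximalRealSubfield (HodgeCM.CMField.K L)) (imagUnitSq (HodgeCM.CMField.K L)) (Rep.ofLineOf ↥(maximalRealSubfield (HodgeCM.CMField.K L)) (imagUnitSq (HodgeCM.CMField.K L))) (locF ↥(maximalRealSubfield (HodgeCM.CMField.K L)) (imagUnitSq (HodgeCM.CMField.K L)) (realUnit ⟨HodgeCM.CMField.K L⟩ (repAt a₀ (Sigma.fst i)).1 (repAt a₀ (Sigma.fst i)).2.1 (repAt a₀ (Sigma.fst i)).2.2)) (realUnit ⟨HodgeCM.CMField.K L⟩ (repAt a₀ (Sigma.fst i)).1 (repAt a₀ (Sigma.fst i)).2.1 (repAt a₀ (Sigma.fst i)).2.2) rfl).toFun j.1.1) j.1.2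
    (OmegaChiSplitting.chiLocalSplittingsD ⟨HodgeCM.CMField.K L⟩ e₁ (frameD V) (frameD_real V) (frameD_ne V) (toHeckeCharacter (L : Type) μ)
      ((isOscillatorChar_toHeckeCharacter_iff μ).mpr hμ) ((Rep.update ↥(maximalRealSubfield (HodgeCM.CMField.K L)) (imagUnitSq (HodgeCM.CMField.K L)) (Rep.ofLineOf ↥(maximalRealSubfield (HodgeCM.CMField.K L)) (imagUnitSq (HodgeCM.CMField.K L))) (locF ↥(maximalRealSubfield (HodgeCM.CMField.K L)) (imagUnitSq (HodgeCM.CMField.K L)) (realUnit ⟨HodgeCM.CMField.K L⟩ (repAt a₀ (Sigma.fst i)).1 (repAt a₀ (Sigma.fst i)).2.1 (repAt a₀ (Sigma.fst i)).2.2)) (realUnit ⟨HodgeCM.CMField.K L⟩ (repAt a₀ (Sigma.fst i)).1 (repAt a₀ (Sigma.fst i)).2.1 (repAt a₀ (Sigma.fst i)).2.2) rfl).toFun j.1.1))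
    (ι := ιV) hιs
    (OmegaChiSplitting.hfac_sChiD ⟨HodgeCM.CMField.K L⟩ e₁ (frameD V) (frameD_real V) (frameD_ne V) (toHeckeCharacter (L : Type) μ)
      (isUnitary_toHeckeCharacter (L : Type) μ) ((isOscillatorChar_toHeckeCharacter_iff μ).mpr hμ) ((Rep.update ↥(maximalRealSubfield (HodgeCM.CMField.K L)) (imagUnitSq (HodgeCM.CMField.K L)) (Rep.ofLineOf ↥(maximalRealSubfield (HodgeCM.CMField.K L)) (imagUnitSq (HodgeCM.CMField.K L))) (locF ↥(maximalRealSubfield (HodgeCM.CMField.K L)) (imagUnitSq (HodgeCM.CMField.K L)) (realUnit ⟨HodgeCM.CMField.K L⟩ (repAt a₀ (Sigma.fst i)).1 (repAt a₀ (Sigma.fst i)).2.1 (repAt a₀ (Sigma.fst i)).2.2)) (realUnit ⟨HodgeCM.CMField.K L⟩ (repAt a₀ (Sigma.fst i)).1 (repAt a₀ (Sigma.fst i)).2.1 (repAt a₀ (Sigma.fst i)).2.2) rfl).toFun j.1.1))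
    (le_refl 3) (localMu (L : Type) (toHeckeCharacter (L : Type) μ))
    (fun v x => norm_localMu (L : Type) (toHeckeCharacter (L : Type) μ) v (isUnitary_toHeckeCharacter (L : Type) μ) x)
    (continuous_localMu (L : Type) (toHeckeCharacter (L : Type) μ))
    (fun v t => localMu_toLocalRing_eq_one_iff (L : Type) (toHeckeCharacter (L : Type) μ) v
      ((isOscillatorChar_toHeckeCharacter_iff μ).mpr hμ) t)
    hD1

set_option synthInstance.maxHeartbeats 400000 in
set_option maxHeartbeats 6400000 in
/-- **`ω_j ≠ 0` at the rests `(𝕌₁ i).rest t` over the untwisted datum** — the Δ2 junction's `hnvD` input of the END read at `sec42DataIdOf`,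
for ANY tail `t`: `Representation.IsIrreducible.nontrivial` on the previous theorem ([Liu2021] App. D Lem. D.1 (1) AS PRINTED at the local
Weil data of `j`).  HC_CM is NOT proved. [cite: Liu2021, Def. 4.11 (FJcycle.tex l. 2094–2096), Appendix D, Lemma D.1 (1) (l. 5229)] -/
theorem nontrivial_omegaAt_indexOfRecordId_of_lemD1AsPrinted
    {L : HodgeCM.CMField} {ι₁ : (L : Type) →+* ℂ} (V : HodgeCM.HermSpace3 L ι₁) (a₀ : RealScalar L)
    (ιV : ↥V.adelicFin →*
      ↥(UnitaryGroup.finAdelic (↥(maximalRealSubfield (L : Type))) (L : Type) (IsCMField.complexConj (L : Type)) 3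
        (Matrix.diagonal (frameD V))))
    (h : exists_recordSystem) [IsGalois ℚ (L : Type)] (Φ : CMType (L : Type))
    (i : (I V (repAt a₀) (muLiu ι₁ GramClass.rep))) (μ : Literature.NumberTheory.Automorphic.IdeleClassGroup (L : Type) →ₜ* Circle)
    (hμ : IsConjugateSymplectic (L : Type) μ) (hιs : Function.Surjective ιV)
    (t : RestTail (sec42DataIdOf h isoOf ⟨HodgeCM.CMField.K L⟩ ι₁ ⟨HodgeCM.HermSpace3.Hm V, HodgeCM.HermSpace3.isHermitian V, HodgeCM.HermSpace3.signature_ι₁ V, HodgeCM.HermSpace3.posDef_of_ne V⟩ Φ) μ hμ) (j : (toThm418Data (sec42DataIdOf h isoOf ⟨HodgeCM.CMField.K L⟩ ι₁ ⟨HodgeCM.HermSpace3.Hm V, HodgeCM.HermSpace3.isHermitian V, HodgeCM.HermSpace3.signature_ι₁ V, HodgeCM.HermSpace3.posDef_of_ne V⟩ Φ) ((uniformOmegaRepId h ⟨HodgeCM.CMField.K L⟩ ι₁ ⟨HodgeCM.HermSpace3.Hm V, HodgeCM.HermSpace3.isHermitian V, HodgeCM.HermSpace3.signature_ι₁ V,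 HodgeCM.HermSpace3.posDef_of_ne V⟩ Φ e₁ (frameD V) (frameD_real V) (frameD_ne V) ιV (2 * imagUnit (HodgeCM.CMField.K L))⁻¹ (fun _ _ => (Rep.update ↥(maximalRealSubfield (HodgeCM.CMField.K L)) (imagUnitSq (HodgeCM.CMField.K L)) (Rep.ofLineOf ↥(maximalRealSubfield (HodgeCM.CMField.K L)) (imagUnitSq (HodgeCM.CMField.K L))) (locF ↥(maximalRealSubfield (HodgeCM.CMField.K L)) (imagUnitSq (HodgeCM.CMField.K L)) (realUnit ⟨HodgeCM.CMField.K L⟩ (repAt a₀ (Sigma.fst i)).1 (repAt a₀ (Sigma.fst i)).2.1 (repAt a₀ (Sigma.fst i)).2.2)) (realUnit ⟨HodgeCM.CMField.K L⟩ (repAt a₀ (Sigma.fst i)).1 (repAt a₀ (Sigma.fst i)).2.1 (repAt a₀ (Sigma.fst i)).2.2) rfl))).rest t)).AdmIndex)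
    (hD1 : ∀ v : HeightOneSpectrum (𝓞 ↥(maximalRealSubfield (L : Type))), LemD1_1AsPrinted
      (Def411WeilCarriers.localLemD1Data ↥(maximalRealSubfield (L : Type)) (L : Type) (IsCMField.complexConj (L : Type)) 3 e₁
        (Matrix.diagonal (frameD V)) (complexConj_imagUnit (L : Type)) (imagUnit_ne_zero (L : Type)) (imagUnit_mul_self (L : Type))
        (realDiagonal_isSymm (L : Type) (frameD V) (frameD_real V))
        (isUnit_det_realDiagonal (L : Type) (frameD V) (frameD_real V) (frameD_ne V))
        (realDiagonal_map (L : Type) (frameD V) (frameD_real V)).symm ((Rep.update ↥(maximalRealSubfield (HodgeCM.CMField.K L)) (imagUnitSq (HodgeCM.CMField.K L)) (Rep.ofLineOf ↥(maximalRealSubfield (HodgeCM.CMField.K L)) (imagUnitSq (HodgeCM.CMField.K L))) (locF ↥(maximalRealSubfield (HodgeCM.CMField.K L)) (imagUnitSq (HodgeCM.CMField.K L)) (realUnit ⟨HodgeCM.CMField.K L⟩ (repAt a₀ (Sigma.fst i)).1 (repAt a₀ (Sigma.fst i)).2.1 (repAt a₀ (Sigma.fst i)).2.2)) (realUnit ⟨HodgeCM.CMField.K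 L⟩ (repAt a₀ (Sigma.fst i)).1 (repAt a₀ (Sigma.fst i)).2.1 (repAt a₀ (Sigma.fst i)).2.2) rfl).toFun j.1.1)
        (OmegaChiSplitting.chiLocalSplittingsD ⟨HodgeCM.CMField.K L⟩ e₁ (frameD V) (frameD_real V) (frameD_ne V)
          (toHeckeCharacter (L : Type) μ) ((isOscillatorChar_toHeckeCharacter_iff μ).mpr hμ) ((Rep.update ↥(maximalRealSubfield (HodgeCM.CMField.K L)) (imagUnitSq (HodgeCM.CMField.K L)) (Rep.ofLineOf ↥(maximalRealSubfield (HodgeCM.CMField.K L)) (imagUnitSq (HodgeCM.CMField.K L))) (locF ↥(maximalRealSubfield (HodgeCM.CMField.K L)) (imagUnitSq (HodgeCM.CMField.K L)) (realUnit ⟨HodgeCM.CMField.K L⟩ (repAt a₀ (Sigma.fst i)).1 (repAt a₀ (Sigma.fst i)).2.1 (repAt a₀ (Sigma.fst i)).2.2)) (realUnit ⟨HodgeCM.CMField.K L⟩ (repAt a₀ (Sigma.fst i)).1 (repAt a₀ (Sigma.fst i)).2.1 (repAt a₀ (Sigma.fst i)).2.2) rfl).toFun j.1.1))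
        (le_refl 3) (localMu (L : Type) (toHeckeCharacter (L : Type) μ))
        (fun v x => norm_localMu (L : Type) (toHeckeCharacter (L : Type) μ) v (isUnitary_toHeckeCharacter (L : Type) μ) x)
        (continuous_localMu (L : Type) (toHeckeCharacter (L : Type) μ))
        (fun v t => localMu_toLocalRing_eq_one_iff (L : Type) (toHeckeCharacter (L : Type) μ) v
          ((isOscillatorChar_toHeckeCharacter_iff μ).mpr hμ) t)
        j.1.2.1
        (Def411WeilCarriers.norm_chi_eq_one ↥(maximalRealSubfield (L : Type)) (L : Type) (IsCMField.complexConj (L : Type))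
          (Algebra.IsQuadraticExtension.finrank_eq_two ↥(maximalRealSubfield (L : Type)) (L : Type))
          (UnitaryGroup.algEquiv_ne_one_of_apply_eq_neg ↥(maximalRealSubfield (L : Type)) (L : Type) (IsCMField.complexConj (L : Type))
            (complexConj_imagUnit (L : Type)) (imagUnit_ne_zero (L : Type))) j.1.2)
        j.1.2.2.1 v)) :
    Nontrivial ((toThm418Data (sec42DataIdOf h isoOf ⟨HodgeCM.CMField.K L⟩ ι₁ ⟨HodgeCM.HermSpace3.Hm V, HodgeCM.HermSpace3.isHermitian V, HodgeCM.HermSpace3.signature_ι₁ V, HodgeCM.HermSpace3.posDef_of_ne V⟩ Φ) ((uniformOmegaRepId h ⟨HodgeCM.CMField.K L⟩ ι₁ ⟨HodgeCM.HermSpace3.Hm V, HodgeCM.HermSpace3.isHermitian V, HodgeCM.HermSpace3.signature_ι₁ V, HodgeCM.HermSpace3.posDef_of_ne V⟩ Φ e₁ (frameD V) (frameD_real V) (frameD_ne V) ιV (2 * imagUnit (HodgeCM.CMField.K L))⁻¹ (fun _ _ => (Rep.update ↥(maximalRealSubfield (HodgeCM.CMField.K L)) (imagUnitSq (HodgeCM.CMField.K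 L)) (Rep.ofLineOf ↥(maximalRealSubfield (HodgeCM.CMField.K L)) (imagUnitSq (HodgeCM.CMField.K L))) (locF ↥(maximalRealSubfield (HodgeCM.CMField.K L)) (imagUnitSq (HodgeCM.CMField.K L)) (realUnit ⟨HodgeCM.CMField.K L⟩ (repAt a₀ (Sigma.fst i)).1 (repAt a₀ (Sigma.fst i)).2.1 (repAt a₀ (Sigma.fst i)).2.2)) (realUnit ⟨HodgeCM.CMField.K L⟩ (repAt a₀ (Sigma.fst i)).1 (repAt a₀ (Sigma.fst i)).2.1 (repAt a₀ (Sigma.fst i)).2.2) rfl))).rest t)).omegaAt j) :=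
  haveI := isIrreducible_rhoAt_indexOfRecordId_of_lemD1AsPrinted V a₀ ιV h Φ i μ hμ hιs t j hD1
  Representation.IsIrreducible.nontrivial ((toThm418Data (sec42DataIdOf h isoOf ⟨HodgeCM.CMField.K L⟩ ι₁ ⟨HodgeCM.HermSpace3.Hm V, HodgeCM.HermSpace3.isHermitian V, HodgeCM.HermSpace3.signature_ι₁ V, HodgeCM.HermSpace3.posDef_of_ne V⟩ Φ) ((uniformOmegaRepId h ⟨HodgeCM.CMField.K L⟩ ι₁ ⟨HodgeCM.HermSpace3.Hm V, HodgeCM.HermSpace3.isHermitian V, HodgeCM.HermSpace3.signature_ι₁ V, HodgeCM.HermSpace3.posDef_of_ne V⟩ Φ e₁ (frameD V) (frameD_real V) (frameD_ne V) ιV (2 * imagUnit (HodgeCM.CMField.K L))⁻¹ (fun _ _ => (Rep.update ↥(maximalRealSubfield (HodgeCM.CMField.K L)) (imagUnitSq (HodgeCM.CMField.K L)) (Rep.ofLineOf ↥(maximalRealSubfield (HodgeCM.CMField.K L)) (imagUnitSq (HodgeCM.CMField.K L))) (locF ↥(maximalRealSubfield (HodgeCM.CMField.K L)) (imagUnitSq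 (HodgeCM.CMField.K L)) (realUnit ⟨HodgeCM.CMField.K L⟩ (repAt a₀ (Sigma.fst i)).1 (repAt a₀ (Sigma.fst i)).2.1 (repAt a₀ (Sigma.fst i)).2.2)) (realUnit ⟨HodgeCM.CMField.K L⟩ (repAt a₀ (Sigma.fst i)).1 (repAt a₀ (Sigma.fst i)).2.1 (repAt a₀ (Sigma.fst i)).2.2) rfl))).rest t)).rhoAt j)

end Summit.HodgeConjecture.CorCM.D2Bridge.Iota1

end
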